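import Literature.Algebra.Homology.ScalarFilteredInfiniteCyclicExtension
import HarnessLib

/-!
# Scalar-type filtrations along poly-(infinite cyclic) chains of subgroups

Topic `Algebra/Homology`; namespace `Literature.Algebra.Homology`.  Definitions with bodies and
theorems; Mathlib + `ScalarFilteredInfiniteCyclicExtension` (the one-step ascent) +
`CoinducedConjugation` (`subgroupConj`, `resConj`: the pair maps of conjugation by an ambient element).

* `scalarFiltered_iff_of_mulEquiv` — scalar-type filtrations of pair maps are invariant under an
  isomorphism of pairs `e : G ≃* H` (Mathlib's `groupCohomology.mapIso`);
* `scalarFiltered_conj_of_chain` — **poly-ℤ induction**: let `c 0 ≤ c 1 ≤ ⋯ ≤ c m` be subgroups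
  of a group `𝔊`, each normal in the next with infinite cyclic quotient generated by some `tᵢ`, let
  `A` be a representation of `𝔊` over a field and `s : X → 𝔊` elements normalising every `c i`
  into itself and commuting with the `tᵢ`.  If the pair maps `Hⁿ(γ ↦ s_x⁻¹ γ s_x, ρ(s_x))` on
  `Hⁿ(c 0, A)` are scalar-filtered with characters `S` for all `n`, so are those on `Hⁿ(c m, A)`.

This is the passage from the unipotent lattice to `lattice ⋊ units` for the torus operators on the
cohomology of the Borel strata [Harder1987, §2, (2.3)–(2.8)].

## References

* G. Harder, *Eisenstein cohomology of arithmetic groups. The case GL₂*, Invent. Math. 89 (1987), §2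
  [Harder1987].
* K. S. Brown, *Cohomology of Groups*, GTM 87 (1982), III §8 [Brown1982CohomologyGroups].
-/

noncomputable section

open CategoryTheory groupCohomology Literature.LinearAlgebra

universe u

namespace Literature.Algebra.Homology

/-! ### Transport along an isomorphism of pairs -/

section MulEquiv

variable {k G H : Type u} [Field k] [Group G] [Group H] (e : G ≃* H) (A : Rep.{u} k H) {X : Type*}
  (c₂ : X → (H →* H)) (φ₂ : ∀ x, Rep.res (c₂ x) A ⟶ A) (c₁ : X → (G →* G))
  (hc : ∀ x g, e (c₁ x g) = c₂ x (e g))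

/-- The pair map `φ₂` viewed over `c₁ = e⁻¹ c₂ e` on `A ∘ e`. [folklore] -/
def resPairOfMulEquiv (x : X) : Rep.res (c₁ x) (Rep.res (e : G →* H) A) ⟶ Rep.res (e : G →* H) A :=
  Rep.ofHom (LinearMap.intertwiningMap_of_isIntertwiningMap _ _ (φ₂ x).hom.toLinearMap fun g a => by
    change (φ₂ x).hom (A.ρ (e (c₁ x g)) a) = A.ρ (e g) ((φ₂ x).hom a)
    rw [hc]
    exact Rep.hom_comm_apply (φ₂ x) (e g) a)

/-- Unfolding `resPairOfMulEquiv`. [folklore] -/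
@[simp]
theorem resPairOfMulEquiv_hom_apply (x : X) (a : A) : (resPairOfMulEquiv e A c₂ φ₂ c₁ hc x).hom a = (φ₂ x).hom a :=
  rfl

/-- The restriction-along-`e` map `Hⁿ(H, A) → Hⁿ(G, A ∘ e)`. [folklore] -/
abbrev resAlong (n : ℕ) : groupCohomology A n ⟶ groupCohomology (Rep.res (e : G →* H) A) n :=
  groupCohomology.map (e : G →* H) (𝟙 (Rep.res (e : G →* H) A)) n

/-- `resAlong` is the inverse of Mathlib's `groupCohomology.mapIso`. [folklore] -/
theorem resAlong_eq_mapIso_inv (n : ℕ) : resAlong e A n =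
    (groupCohomology.mapIso (A := A) (B := Rep.res (e : G →* H) A) e (LinearEquiv.refl k _) (fun _ => rfl) n).inv :=
  rfl

/-- `resAlong` is bijective. [folklore] -/
theorem resAlong_bijective (n : ℕ) : Function.Bijective (resAlong e A n).hom := by
  rw [resAlong_eq_mapIso_inv]
  exact (groupCohomology.mapIso (A := A) (B := Rep.res (e : G →* H) A) e (LinearEquiv.refl k _) (fun _ => rfl)
    n).symm.toLinearEquiv.bijective

include hc in
/-- `resAlong` intertwines the pair maps. [folklore] -/
theorem resAlong_pair (φ₁ : ∀ x, Rep.res (c₁ x) (Rep.res (e : G →* H) A) ⟶ Rep.res (e : G →* H) A)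
    (hφ : ∀ x a, (φ₁ x).hom a = (φ₂ x).hom a) (n : ℕ) (x : X) (v : groupCohomology A n) :
    (resAlong e A n).hom ((groupCohomology.map (c₂ x) (φ₂ x) n).hom v) =
      (groupCohomology.map (c₁ x) (φ₁ x) n).hom ((resAlong e A n).hom v) := by
  have h : groupCohomology.map (c₂ x) (φ₂ x) n ≫ resAlong e A n = resAlong e A n ≫ groupCohomology.map (c₁ x) (φ₁ x) n := by
    rw [← groupCohomology.map_comp, ← groupCohomology.map_comp]
    refine map_congr' ?_ _ _ (fun a => ?_) n
    · ext g
      exact (hc x g).symm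
    · change (φ₂ x).hom a = (φ₁ x).hom a
      rw [hφ]
  have := congrArg (fun ψ => ψ.hom v) h
  simpa only [ModuleCat.hom_comp, LinearMap.comp_apply] using this

include hc in
/-- **Scalar-type filtrations of pair maps are invariant under isomorphisms of pairs.** [folklore] -/
theorem scalarFiltered_iff_of_mulEquiv (φ₁ : ∀ x, Rep.res (c₁ x) (Rep.res (e : G →* H) A) ⟶ Rep.res (e : G →* H) A)
    (hφ : ∀ x a, (φ₁ x).hom a = (φ₂ x).hom a) (S : Set (X → k)) (n : ℕ) :
    ScalarFiltered (fun x => (groupCohomology.map (c₂ x) (φ₂ x) n).hom) S ⊤ ↔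
      ScalarFiltered (fun x => (groupCohomology.map (c₁ x) (φ₁ x) n).hom) S ⊤ :=
  ⟨fun h => ScalarFiltered.of_surjective _ (resAlong_bijective e A n).2 (resAlong_pair e A c₂ φ₂ c₁ hc φ₁ hφ n) h,
    fun h => ScalarFiltered.of_injective _ (resAlong_bijective e A n).1 (resAlong_pair e A c₂ φ₂ c₁ hc φ₁ hφ n) h⟩

end MulEquiv

/-! ### Poly-ℤ induction -/

section Chain

variable {k 𝔊 : Type u} [Field k] [Group 𝔊] (A : Rep.{u} k 𝔊) {X : Type*} (s : X → 𝔊) (c : ℕ → Subgroup 𝔊)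
  (hs : ∀ x i, ∀ γ ∈ c i, (s x)⁻¹ * γ * s x ∈ c i) (S : Set (X → k))

/-- The pair operators `Hⁿ(γ ↦ s_x⁻¹ γ s_x, ρ(s_x))` on `Hⁿ(c i, A)`. [folklore] -/
abbrev conjPairEnd (i n : ℕ) (x : X) : Module.End k (groupCohomology (resSub (c i) A) n) :=
  (groupCohomology.map (subgroupConj (c i) (s x) (hs x i)) (resConj (c i) A (s x) (hs x i)) n).hom

/-- **Poly-ℤ induction for scalar-type filtrations.**  See the module docstring.
[cite: Harder1987, §2, (2.3)–(2.8)] [cite: Brown1982CohomologyGroups, III §8] -/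
theorem scalarFiltered_conj_of_chain (h0 : ∀ n, ScalarFiltered (conjPairEnd A s c hs 0 n) S ⊤) :
    ∀ (m : ℕ),
      (∀ i < m, c i ≤ c (i + 1)) →
      (∀ i < m, ((c i).subgroupOf (c (i + 1))).Normal) →
      (∀ i < m, ∃ t ∈ c (i + 1), (∀ x, (s x)⁻¹ * t * s x = t) ∧
        (∀ g ∈ c (i + 1), ∃ h ∈ c i, ∃ n : ℤ, g = h * t ^ n) ∧ (∀ n : ℤ, t ^ n ∈ c i → n = 0)) →
      ∀ n, ScalarFiltered (conjPairEnd A s c hs m n) S ⊤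
  | 0, _, _, _ => h0
  | m + 1, hle, hnorm, hcyc => by
    have ih := scalarFiltered_conj_of_chain h0 m (fun i hi => hle i (Nat.lt_succ_of_lt hi))
      (fun i hi => hnorm i (Nat.lt_succ_of_lt hi)) (fun i hi => hcyc i (Nat.lt_succ_of_lt hi))
    have hle' : c m ≤ c (m + 1) := hle m (Nat.lt_succ_self m)
    haveI hN : ((c m).subgroupOf (c (m + 1))).Normal := hnorm m (Nat.lt_succ_self m)
    obtain ⟨t, ht, hts, hgen, hfree⟩ := hcyc m (Nat.lt_succ_self m)
    intro n
    -- the data of `scalarFiltered_of_infiniteCyclicExtension` for `H = c m ≤ G = c (m + 1)`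
    let G : Type u := ↥(c (m + 1))
    let H : Subgroup G := (c m).subgroupOf (c (m + 1))
    let A' : Rep k G := resSub (c (m + 1)) A
    let c' : X → (G →* G) := fun x => subgroupConj (c (m + 1)) (s x) (hs x (m + 1))
    have hc' : ∀ x, ∀ h ∈ H, c' x h ∈ H := fun x h hh =>
      Subgroup.mem_subgroupOf.2 (hs x m _ (Subgroup.mem_subgroupOf.1 hh))
    have hct : ∀ x, c' x ⟨t, ht⟩ = ⟨t, ht⟩ := fun x => Subtype.ext (hts x)
    let φ' : ∀ x, Rep.res (c' x) A' ⟶ A' := fun x => resConj (c (m + 1)) A (s x) (hs x (m + 1))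
    have hgen' : ∀ g : G, ∃ (h : H) (n : ℤ), g = (h : G) * (⟨t, ht⟩ : G) ^ n := by
      intro g
      obtain ⟨h, hh, n, hg⟩ := hgen g g.2
      refine ⟨⟨⟨h, hle' hh⟩, Subgroup.mem_subgroupOf.2 hh⟩, n, Subtype.ext ?_⟩
      rw [Subgroup.coe_mul, SubgroupClass.coe_zpow]
      exact hg
    have hfree' : ∀ n : ℤ, (⟨t, ht⟩ : G) ^ n ∈ H → n = 0 := fun n hn => by
      have h1 : (((⟨t, ht⟩ : G) ^ n : G) : 𝔊) ∈ c m := Subgroup.mem_subgroupOf.1 hn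
      rw [SubgroupClass.coe_zpow] at h1
      exact hfree n h1
    -- the induction hypothesis, transported to `H ≅ c m`
    let e : H ≃* ↥(c m) := Subgroup.subgroupOfEquivOfLe hle'
    have ih' : ∀ n, ScalarFiltered (fun x => (groupCohomology.map (restrictEnd H (c' x) (hc' x))
        (resPair H A' (c' x) (hc' x) (φ' x)) n).hom) S ⊤ := by
      intro n
      exact (scalarFiltered_iff_of_mulEquiv e (resSub (c m) A)
        (fun x => subgroupConj (c m) (s x) (hs x m)) (fun x => resConj (c m) A (s x) (hs x m))
        (fun x => restrictEnd H (c' x) (hc' x)) (fun x g => Subtype.ext rfl)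
        (fun x => resPair H A' (c' x) (hc' x) (φ' x)) (fun x a => rfl) S n).1 (ih n)
    exact scalarFiltered_of_infiniteCyclicExtension H A' ⟨t, ht⟩ hgen' hfree' c' hc' hct φ' S ih' n

end Chain

end Literature.Algebra.Homology

end
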